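import Literature.AnabelianGeometry.SemiGraphs.TemperedPiCharacteristicTowerOfCharCores
import HarnessLib

/-!
# [SemiAnbd] Ex. 3.10 — the bridge with the level hypotheses required only EVENTUALLY
# (towers that start at a level with smooth reduction; Ex. 3.10 pp. 44–45, §1 p. 12)

Mochizuki, *Semi-graphs of anabelioids*, Publ. RIMS **42** (2006) [SemiAnbd], Example 3.10 pp. 44–45
("an exhaustive sequence of open characteristic … subgroups … `Δ ↠ … ↠ Δ[i] ↠ … ↠ Δ[j] ↠ …`", "`Δ` is the
inverse limit of the `Δ[i]`"). [cite: MochizukiSemiAnbd2006, Ex 3.10 pp.44-45]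

PROOF-ONLY file (abc-iut cell, prover abc-iut-w5-d240; no definitions, no instances, no named facts).
`TemperedCurve.tower_of_specialFibreTower_of_finite` (`TemperedPiCharacteristicTowerOfCharCores.lean`)
asks every level `𝒢_i` of the special-fibre tower to carry a closed edge.  For the printed tower of a
curve with GOOD reduction the level `i = 0` is one vertex with cusps — no closed edge, compact `π₁^temp`
(`TemperedPiCompactOfNoClosedEdge.lean`) — so that clause fails as typed although every sufficiently deep
level of the SAME tower may be singular (remark of seat abc-iut-f-174, 2026-08-26).  Since the surjections
`Δ[i'] ↠ Δ[i]` make the inverse-limit clause COFINAL in the level ("for every neighbourhood and every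
`i₀` some level `i ≥ i₀` realises it"), the bridge needs its level hypotheses only EVENTUALLY:

* `TemperedCurve.piNormal_deltaTower_of_specialFibreTower_eventually` /
  `TemperedCurve.tower_of_specialFibreTower_eventually` — (P0) + the COFINAL inverse-limit clause (h1′)
  + a characteristic André tower at every level `i ≥ i₀` ⟹ `htower₀(Π^temp_{X_K})`;
* `TemperedCurve.tower_of_specialFibreTower_of_eventually_singular` (+ `'` under `d : X.GroupLevelData`)
  — the same with the leaf discharged by `TemperedPiChart.charTower_of_coherent` at the levels
  `i ≥ i₀`, which are asked to be finite, coherent and to carry a closed edge ("(L-sing′)": the stable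
  reduction is singular from some level on).

Nothing of the paper is asserted; nothing here bears on [IUTchIII] Cor. 3.12 or takes a side.
-/

noncomputable section

namespace Literature.AnabelianGeometry.SemiGraphs

open _root_.Topology

universe u

namespace TemperedCurve

variable {p : ℕ} [Fact p.Prime] (X : TemperedCurve p)

/-- **The `Π`-normal André tower of `Δ^temp_X` from a special-fibre tower whose leaf holds from some
level on**: (P0), the COFINAL inverse-limit clause (h1′) "for every neighbourhood `U` of `1` in `Δ^temp_X`
and every `i₀` there is a level `i ≥ i₀` and a neighbourhood of `1` in `π₁^temp(𝒢_i)` whose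
`adm_i`-preimage lies in `U`", and a characteristic André tower at every level `i ≥ i₀`.
[cite: MochizukiSemiAnbd2006, Ex 3.10 pp.44-45] -/
theorem piNormal_deltaTower_of_specialFibreTower_eventually (T : SpecialFibreTower X.DeltaTemp)
    (hP0 : ∀ i, ((T.admKer i).map X.DeltaTemp.subtype).Normal)
    (hlim : ∀ U ∈ 𝓝 (1 : X.DeltaTemp), ∀ i₀ : ℕ, ∃ i, i₀ ≤ i ∧ ∃ V ∈ 𝓝 (1 : (T.chart i).G),
      ∀ n : T.N i, T.adm i n ∈ V → (n : X.DeltaTemp) ∈ U)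
    (i₀ : ℕ)
    (hch : ∀ i, i₀ ≤ i → ∀ V ∈ 𝓝 (1 : (T.chart i).G), ∃ MQ : OpenNormalSubgroup (T.chart i).G,
      (MQ : Set (T.chart i).G) ⊆ V ∧
      (∀ φ : (T.chart i).G ≃ₜ* (T.chart i).G,
        MQ.toSubgroup.map φ.toMulEquiv.toMonoidHom ≤ MQ.toSubgroup) ∧
      ∃ (G : Subgroup ((T.chart i).G ⧸ MQ.toSubgroup)) (_ : IsFreeGroup G), G.FiniteIndex ∧
        Finite (IsFreeGroup.Generators G) ∧ ∃ a ∈ G, ∃ b ∈ G, a * b ≠ b * a) :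
    ∀ U ∈ 𝓝 (1 : X.PiTemp), ∃ M : OpenNormalSubgroup X.DeltaTemp,
      (M.toSubgroup.map X.DeltaTemp.subtype).Normal ∧ (∀ x ∈ M, (x : X.PiTemp) ∈ U) ∧
      ∃ (G : Subgroup (X.DeltaTemp ⧸ M.toSubgroup)) (_ : IsFreeGroup G), G.FiniteIndex ∧
        Finite (IsFreeGroup.Generators G) ∧ ∃ a ∈ G, ∃ b ∈ G, a * b ≠ b * a := by
  haveI : X.DeltaTemp.Normal := by unfold TemperedCurve.DeltaTemp; infer_instance
  intro U hU
  have hU' : ((↑) : X.DeltaTemp → X.PiTemp) ⁻¹' U ∈ 𝓝 (1 : X.DeltaTemp) :=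
    continuous_subtype_val.continuousAt.preimage_mem_nhds (by simpa using hU)
  obtain ⟨i, hi, V, hV, hVU⟩ := hlim _ hU' i₀
  obtain ⟨MQ, hMQV, hchar, G, hG, hGfi, hGfin, hab⟩ := hch i hi V hV
  haveI := hGfi
  obtain ⟨M, hMpi, hMmem, K, hK, hKfi, hKfin, habK⟩ :=
    T.exists_openNormal_piNormal_of_charLevel hP0 i MQ hchar G hG hGfin hab
  refine ⟨M, hMpi, fun x hx => ?_, K, hK, hKfi, hKfin, habK⟩
  obtain ⟨n, hn, rfl⟩ := (hMmem x).1 hx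
  exact hVU n (hMQV hn)

/-- **[SemiAnbd] Ex. 3.10 — the bridge with the leaf required only from some level on**: for
`X : TemperedCurve p` with `Π^temp_{X_K}` tempered and first countable, a special-fibre tower over
`Δ^temp_X` with (P0), the cofinal inverse-limit clause (h1′) and a characteristic André tower at every
level `i ≥ i₀` gives `htower₀(Π^temp_{X_K})`. [cite: MochizukiSemiAnbd2006, Ex 3.10 pp.44-45] -/
theorem tower_of_specialFibreTower_eventually (hT : IsTempered X.PiTemp) [FirstCountableTopology X.PiTemp]
    (T : SpecialFibreTower X.DeltaTemp)
    (hP0 : ∀ i, ((T.admKer i).map X.DeltaTemp.subtype).Normal)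
    (hlim : ∀ U ∈ 𝓝 (1 : X.DeltaTemp), ∀ i₀ : ℕ, ∃ i, i₀ ≤ i ∧ ∃ V ∈ 𝓝 (1 : (T.chart i).G),
      ∀ n : T.N i, T.adm i n ∈ V → (n : X.DeltaTemp) ∈ U)
    (i₀ : ℕ)
    (hch : ∀ i, i₀ ≤ i → ∀ V ∈ 𝓝 (1 : (T.chart i).G), ∃ MQ : OpenNormalSubgroup (T.chart i).G,
      (MQ : Set (T.chart i).G) ⊆ V ∧
      (∀ φ : (T.chart i).G ≃ₜ* (T.chart i).G,
        MQ.toSubgroup.map φ.toMulEquiv.toMonoidHom ≤ MQ.toSubgroup) ∧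
      ∃ (G : Subgroup ((T.chart i).G ⧸ MQ.toSubgroup)) (_ : IsFreeGroup G), G.FiniteIndex ∧
        Finite (IsFreeGroup.Generators G) ∧ ∃ a ∈ G, ∃ b ∈ G, a * b ≠ b * a) :
    ∀ U ∈ 𝓝 (1 : X.PiTemp), ∃ N : OpenNormalSubgroup X.PiTemp, (N : Set X.PiTemp) ⊆ U ∧
      ∃ (G : Subgroup (X.PiTemp ⧸ N.toSubgroup)) (_ : IsFreeGroup G), G.Normal ∧ G.FiniteIndex ∧
        Finite (IsFreeGroup.Generators G) ∧ ∃ a ∈ G, ∃ b ∈ G, a * b ≠ b * a :=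
  X.tower_of_piNormal_deltaTower hT
    (X.piNormal_deltaTower_of_specialFibreTower_eventually T hP0 hlim i₀ hch)

/-- **[SemiAnbd] Ex. 3.10 — the bridge for towers that are SINGULAR FROM SOME LEVEL ON** (L-sing′):
`htower₀(Π^temp_{X_K})` from a special-fibre tower over `Δ^temp_X` with (P0), the cofinal inverse-limit
clause (h1′), and levels `𝒢_i`, `i ≥ i₀`, that are finite, coherent and carry a closed edge (leaf
discharged by `TemperedPiChart.charTower_of_coherent`).  Levels below `i₀` — e.g. a smooth special fibre,
one vertex with cusps — are unconstrained. [cite: MochizukiSemiAnbd2006, Ex 3.10 pp.44-45] -/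
theorem tower_of_specialFibreTower_of_eventually_singular (hT : IsTempered X.PiTemp)
    [FirstCountableTopology X.PiTemp] (T : SpecialFibreTower X.DeltaTemp)
    (hP0 : ∀ i, ((T.admKer i).map X.DeltaTemp.subtype).Normal)
    (hlim : ∀ U ∈ 𝓝 (1 : X.DeltaTemp), ∀ i₀ : ℕ, ∃ i, i₀ ≤ i ∧ ∃ V ∈ 𝓝 (1 : (T.chart i).G),
      ∀ n : T.N i, T.adm i n ∈ V → (n : X.DeltaTemp) ∈ U)
    (i₀ : ℕ) (hfinV : ∀ i, i₀ ≤ i → Finite (T.Gc i).graph.Vertex)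
    (hfinE : ∀ i, i₀ ≤ i → Finite (T.Gc i).graph.Edge) (hcoh : ∀ i, i₀ ≤ i → (T.Gc i).IsCoherent)
    (hcl : ∀ i, i₀ ≤ i → ∃ e : (T.Gc i).graph.Edge, (T.Gc i).graph.IsClosedEdge e) :
    ∀ U ∈ 𝓝 (1 : X.PiTemp), ∃ N : OpenNormalSubgroup X.PiTemp, (N : Set X.PiTemp) ⊆ U ∧
      ∃ (G : Subgroup (X.PiTemp ⧸ N.toSubgroup)) (_ : IsFreeGroup G), G.Normal ∧ G.FiniteIndex ∧
        Finite (IsFreeGroup.Generators G) ∧ ∃ a ∈ G, ∃ b ∈ G, a * b ≠ b * a :=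
  X.tower_of_specialFibreTower_eventually hT T hP0 hlim i₀ fun i hi => by
    haveI := hfinV i hi
    haveI := hfinE i hi
    exact (T.chart i).charTower_of_coherent (T.hyp i).toProp36Hypotheses (hcoh i hi) (hcl i hi)

/-- The same under the parameter bundle `d : X.GroupLevelData` of ruling η′.
[cite: MochizukiSemiAnbd2006, Ex 3.10 pp.44-45] -/
theorem tower_of_specialFibreTower_of_eventually_singular' (d : X.GroupLevelData)
    (T : SpecialFibreTower X.DeltaTemp)
    (hP0 : ∀ i, ((T.admKer i).map X.DeltaTemp.subtype).Normal)
    (hlim : ∀ U ∈ 𝓝 (1 : X.DeltaTemp), ∀ i₀ : ℕ, ∃ i, i₀ ≤ i ∧ ∃ V ∈ 𝓝 (1 : (T.chart i).G),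
      ∀ n : T.N i, T.adm i n ∈ V → (n : X.DeltaTemp) ∈ U)
    (i₀ : ℕ) (hfinV : ∀ i, i₀ ≤ i → Finite (T.Gc i).graph.Vertex)
    (hfinE : ∀ i, i₀ ≤ i → Finite (T.Gc i).graph.Edge) (hcoh : ∀ i, i₀ ≤ i → (T.Gc i).IsCoherent)
    (hcl : ∀ i, i₀ ≤ i → ∃ e : (T.Gc i).graph.Edge, (T.Gc i).graph.IsClosedEdge e) :
    ∀ U ∈ 𝓝 (1 : X.PiTemp), ∃ N : OpenNormalSubgroup X.PiTemp, (N : Set X.PiTemp) ⊆ U ∧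
      ∃ (G : Subgroup (X.PiTemp ⧸ N.toSubgroup)) (_ : IsFreeGroup G), G.Normal ∧ G.FiniteIndex ∧
        Finite (IsFreeGroup.Generators G) ∧ ∃ a ∈ G, ∃ b ∈ G, a * b ≠ b * a := by
  haveI := d.secondCountableTopology
  exact X.tower_of_specialFibreTower_of_eventually_singular d.isTempered T hP0 hlim i₀ hfinV hfinE hcoh hcl

/-- The `Δ^temp_X`-form (composition with abc-iut-w5-d139's `deltaTemp_tower_of_tower_of_isTempered`).
[cite: MochizukiSemiAnbd2006, Ex 3.10 pp.44-45] -/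
theorem deltaTemp_tower_of_specialFibreTower_of_eventually_singular (hT : IsTempered X.PiTemp)
    [FirstCountableTopology X.PiTemp] (T : SpecialFibreTower X.DeltaTemp)
    (hP0 : ∀ i, ((T.admKer i).map X.DeltaTemp.subtype).Normal)
    (hlim : ∀ U ∈ 𝓝 (1 : X.DeltaTemp), ∀ i₀ : ℕ, ∃ i, i₀ ≤ i ∧ ∃ V ∈ 𝓝 (1 : (T.chart i).G),
      ∀ n : T.N i, T.adm i n ∈ V → (n : X.DeltaTemp) ∈ U)
    (i₀ : ℕ) (hfinV : ∀ i, i₀ ≤ i → Finite (T.Gc i).graph.Vertex)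
    (hfinE : ∀ i, i₀ ≤ i → Finite (T.Gc i).graph.Edge) (hcoh : ∀ i, i₀ ≤ i → (T.Gc i).IsCoherent)
    (hcl : ∀ i, i₀ ≤ i → ∃ e : (T.Gc i).graph.Edge, (T.Gc i).graph.IsClosedEdge e) :
    ∀ U ∈ 𝓝 (1 : X.DeltaTemp), ∃ N : OpenNormalSubgroup X.DeltaTemp, (N : Set X.DeltaTemp) ⊆ U ∧
      ∃ (G : Subgroup (X.DeltaTemp ⧸ N.toSubgroup)) (_ : IsFreeGroup G), G.Normal ∧ G.FiniteIndex ∧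
        Finite (IsFreeGroup.Generators G) ∧ ∃ a ∈ G, ∃ b ∈ G, a * b ≠ b * a :=
  X.deltaTemp_tower_of_tower_of_isTempered hT
    (X.tower_of_specialFibreTower_of_eventually_singular hT T hP0 hlim i₀ hfinV hfinE hcoh hcl)

end TemperedCurve

end Literature.AnabelianGeometry.SemiGraphs

end
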